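import Summits.ResolutionOfSingularities.ResolutionOfSingularities.Theorems.FrobeniusLadderFInjectiveMacaulayficationGDDDefs
import Summits.ResolutionOfSingularities.ResolutionOfSingularities.Theorems.FrobeniusLadderFInjectiveMacaulayficationFiLocusOpenOfAffine
import Mathlib.RingTheory.Localization.LocalizationLocalization
import HarnessLib

/-!
# All primes of the cone ⇒ `PuncturedFull` — the localisation plumbing `(G(F)[1/āTᴺ])_𝔐 ≅ G(F)_{𝔐 ∩ G(F)}` (ThmDSig §3d)
# (crux `FInjectiveMacaulayfication` stmt-ResolutionOfSingularities-15315, chain w45a, THEOREM-D / THEOREM Q programme;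
# res-L1-w45a-plan-1 R16.5 (1) / R16.8 (1); text res-L1-w45a-idea-1 `ThmDSig.lean` r17/r18 §3d, seat res-D-pv-019 AS res-L1-w45a-stub-7)

[OURS · L1 W4.5a] Support file (`--supports stmt-ResolutionOfSingularities-15315 --as helper`); NOT a statement of any manuscript; no definitions,
no named facts; AI-written (AI review is weaker than expert review).

* `one_mem_I_zero` — `1 ∈ I₀` (typing device of ThmDSig §3b: the statements over ALL primes of the cone `G(F)` are phrased over
  `Localization.Away (homogBar F 0 1 _)`, which is `G(F)[1/1] ≅ G(F)`);
* `homogBar_zero_one` — `1̄·T⁰ = 1` in `G(F)`;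
* **`puncturedFull_of_cmfiCl`** (ThmDSig r17/r18 §3d VERBATIM, tri-2 junk-read PASS 19:52:59Z) — if the CM clause and the F-clause hold at
  EVERY prime of `G(F)` (i.e. of `G(F)[1/1]`), then `PuncturedFull p F`: for `𝔐` maximal in `G(F)[1/āTᴺ]`,
  `G(F)[1/āTᴺ]` is a localisation of `G(F)[1/1]` (`powers 1 ≤ powers āTᴺ`, Mathlib `IsLocalization.localizationAlgebraOfSubmonoidLe` /
  `isLocalization_of_submonoid_le`), hence `(G(F)[1/āTᴺ])_𝔐` is the localisation of `G(F)[1/1]` at `𝔓 = 𝔐 ∩ G(F)[1/1]`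
  (`isLocalization_isLocalization_atPrime_isLocalization`, `IsLocalization.algEquiv`), and the two clauses travel along the ring
  isomorphism (`FiLocusOpenOfAffine.cmClause_of_ringEquiv` / `fClause_of_ringEquiv`). No `Ideal (assocGraded F)` is formed (that type does
  not elaborate under `Localization.AtPrime`, as ThmDSig notes).
-/

-- single-problem summit: the doubled namespace component is forced
set_option linter.dupNamespace false

noncomputable section

namespace Summit.ResolutionOfSingularities.ResolutionOfSingularities.Theorems.FInjectiveMacaulayfication.GDD

open Summit.ResolutionOfSingularities.ResolutionOfSingularities.Theorems.FInjectiveMacaulayfication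

variable (p : ℕ) (𝒪 : Type) [CommRing 𝒪]

/-- `1 ∈ I₀` (so `1̄·T⁰ ∈ G(F)` makes sense and `G(F)[1/1̄·T⁰] = G(F)`). [typing device of ThmDSig §3b; folklore] -/
theorem one_mem_I_zero (F : MultFiltration 𝒪) : (1 : 𝒪) ∈ F.I 0 := by
  rw [F.I_zero]; trivial

/-- `1̄·T⁰ = 1` in the associated graded ring `G(F)`. [folklore] -/
theorem homogBar_zero_one (F : MultFiltration 𝒪) : homogBar F 0 1 (one_mem_I_zero 𝒪 F) = 1 := by
  have h : homog F 0 1 (one_mem_I_zero 𝒪 F) = 1 := by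
    apply Subtype.ext
    change LaurentPolynomial.C (1 : 𝒪) * LaurentPolynomial.T ((0 : ℕ) : ℤ) = 1
    rw [map_one, one_mul, Nat.cast_zero, LaurentPolynomial.T_zero]
  unfold homogBar
  rw [h, map_one]

-- the quotient-of-subalgebra cone `assocGraded F` makes instance synthesis slow; generous budgets, no change of meaning
set_option synthInstance.maxHeartbeats 200000 in
set_option maxHeartbeats 1600000 in
/-- **All primes of the cone ⇒ `PuncturedFull`** (ThmDSig §3d, VERBATIM): if the CM clause and the F-clause hold at every prime of
`G(F)[1/1̄·T⁰] (≅ G(F))`, they hold at every maximal ideal of every basic open `G(F)[1/āTᴺ]`, `N ≥ 1`, `a ∈ I_N` — the localisation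
`(G(F)[1/āTᴺ])_𝔐` is `G(F)_{𝔐 ∩ G(F)}`, which is `(G(F)[1/1])_𝔓` for the corresponding prime `𝔓`. [Mathlib localisation API; folklore] -/
theorem puncturedFull_of_cmfiCl (F : MultFiltration 𝒪)
    (hall : ∀ (𝔓 : Ideal (Localization.Away (homogBar F 0 1 (one_mem_I_zero 𝒪 F)))) [𝔓.IsPrime],
      SliceableCentre.CMCl (Localization.AtPrime 𝔓) ∧ SliceableCentre.FCl p (Localization.AtPrime 𝔓)) :
    PuncturedFull p F := by
  intro N hN a ha 𝔐 h𝔐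
  -- `G₁ = G[1/1̄T⁰]` and `G_a = G[1/āTᴺ]` are localisations of `G = G(F)` at `powers 1 ≤ powers (āTᴺ)`, so `G_a` is a
  -- localisation of `G₁` and `(G_a)_𝔐` is the localisation of `G₁` at `𝔓 := 𝔐 ∩ G₁`
  have hy : homogBar F 0 1 (one_mem_I_zero 𝒪 F) = 1 := homogBar_zero_one 𝒪 F
  have hle : Submonoid.powers (homogBar F 0 1 (one_mem_I_zero 𝒪 F)) ≤ Submonoid.powers (homogBar F N a ha) := by
    rintro _ ⟨n, rfl⟩
    change homogBar F 0 1 (one_mem_I_zero 𝒪 F) ^ n ∈ Submonoid.powers (homogBar F N a ha)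
    rw [hy, one_pow]
    exact Submonoid.one_mem _
  letI alg : Algebra (Localization.Away (homogBar F 0 1 (one_mem_I_zero 𝒪 F))) (Localization.Away (homogBar F N a ha)) :=
    (IsLocalization.map (M := Submonoid.powers (homogBar F 0 1 (one_mem_I_zero 𝒪 F)))
      (T := Submonoid.powers (homogBar F N a ha)) (Localization.Away (homogBar F N a ha))
      (RingHom.id (assocGraded F)) (fun z hz => by simpa using hle hz)).toAlgebra
  haveI hst : IsScalarTower (assocGraded F) (Localization.Away (homogBar F 0 1 (one_mem_I_zero 𝒪 F)))
      (Localization.Away (homogBar F N a ha)) := by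
    refine IsScalarTower.of_algebraMap_eq' (R := assocGraded F)
      (S := Localization.Away (homogBar F 0 1 (one_mem_I_zero 𝒪 F))) (A := Localization.Away (homogBar F N a ha)) ?_
    change algebraMap (assocGraded F) (Localization.Away (homogBar F N a ha)) =
      (IsLocalization.map (M := Submonoid.powers (homogBar F 0 1 (one_mem_I_zero 𝒪 F)))
        (T := Submonoid.powers (homogBar F N a ha)) (Localization.Away (homogBar F N a ha))
        (RingHom.id (assocGraded F)) (fun z hz => by simpa using hle hz)).comp
        (algebraMap (assocGraded F) (Localization.Away (homogBar F 0 1 (one_mem_I_zero 𝒪 F))))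
    rw [IsLocalization.map_comp, RingHom.comp_id]
  -- `G_a` is a localisation of `G₁` (at the image of `powers āTᴺ`; packed existentially to keep elaboration first-order)
  obtain ⟨M', hM'⟩ : ∃ M' : Submonoid (Localization.Away (homogBar F 0 1 (one_mem_I_zero 𝒪 F))),
      IsLocalization M' (Localization.Away (homogBar F N a ha)) :=
    ⟨_, IsLocalization.isLocalization_of_submonoid_le (R := assocGraded F)
      (Localization.Away (homogBar F 0 1 (one_mem_I_zero 𝒪 F))) (Localization.Away (homogBar F N a ha))
      (Submonoid.powers (homogBar F 0 1 (one_mem_I_zero 𝒪 F))) (Submonoid.powers (homogBar F N a ha)) hle⟩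
  haveI := hM'
  let 𝔓 : Ideal (Localization.Away (homogBar F 0 1 (one_mem_I_zero 𝒪 F))) :=
    Ideal.comap (algebraMap (Localization.Away (homogBar F 0 1 (one_mem_I_zero 𝒪 F)))
      (Localization.Away (homogBar F N a ha))) 𝔐
  haveI h𝔓 : 𝔓.IsPrime := Ideal.comap_isPrime _ 𝔐
  haveI hat : IsLocalization.AtPrime (Localization.AtPrime 𝔐) 𝔓 :=
    IsLocalization.isLocalization_isLocalization_atPrime_isLocalization M' (Localization.AtPrime 𝔐) 𝔐
  let e : Localization.AtPrime 𝔓 ≃+* Localization.AtPrime 𝔐 :=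
    (IsLocalization.algEquiv (R := Localization.Away (homogBar F 0 1 (one_mem_I_zero 𝒪 F)))
      𝔓.primeCompl (Localization.AtPrime 𝔓) (Localization.AtPrime 𝔐)).toRingEquiv
  -- transport the clauses along `(G₁)_𝔓 ≅ (G_a)_𝔐`
  obtain ⟨hCM, hF⟩ := hall 𝔓
  exact ⟨FiLocusOpenOfAffine.cmClause_of_ringEquiv e hCM, FiLocusOpenOfAffine.fClause_of_ringEquiv p e hF⟩

end Summit.ResolutionOfSingularities.ResolutionOfSingularities.Theorems.FInjectiveMacaulayfication.GDD

end
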